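import Mathlib.Analysis.SpecialFunctions.Pow.Real
import Mathlib.Data.Complex.Basic
import Literature.Computability.AlgebraicComplexity.Elusive
import HarnessLib

/-!
# Narayanan's doubling curve is `(⌊m^{9/10}⌋, 2)`-elusive (arXiv 2026) — claim recorded as a named fact

Topic `Literature/Computability/AlgebraicComplexity`; problem `ValiantsHypothesis`, route `GirthSidon`:
the only printed elusiveness result in Raz's `(m^{0.9}, 2)` regime, A. K. Narayanan, *Arithmetic
circuit lower bounds from sumset expansion*, arXiv:2607.15848 (July 2026, UNREFEREED — recorded with a
`claim` tag, D-0012), Theorem 1 (p. 2): "For large enough `m`, `z ↦ (z, z², z⁴, …, z^{2^{m−1}})` is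
`(⌊m^{9/10}⌋, 2)`-elusive." His Definition 1 (p. 2: "`f : ℂⁿ → ℂᵐ` is `(s, r)`-elusive if
`f(ℂⁿ) ⊄ Γ(ℂˢ)` for every degree-`r` map `Γ : ℂˢ → ℂᵐ`", degree-`r` = every coordinate a polynomial
of degree at most `r`) is Raz 2010 Def. 1.1 = the tree's `IsElusive` verbatim, so the statement below
is the printed one with the curve written as the monomial map `i ↦ X₀^{2^i}` on `Fin m` (0-indexed:
exponents `2^0, …, 2^{m−1}`).

It is the nearest prior art of the route target
`Summit.ValiantsHypothesis.ValiantsHypothesis.Theses.GirthSidon.MomentCurveElusive` (same regime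
`s ≤ m^{0.9}`, `r = 2`, but a POLYNOMIAL-height B₃₀ power-sum curve instead of the doubling curve of
height `2^{m−1}`); by his Remark after Thm 1 (p. 3: "Any significant lowering of the degree in theorem 1,
such as to a subexponential `2^{m^{o(1)}}`, implies VP ≠ VNP") the fact itself does not feed Raz's
theorem (`Raz2010_result_1`, proved in tree) — it is recorded for grounding/novelty, and as a usable
hypothesis for comparison arguments (`IsElusive.anti_left`: elusiveness is antitone in `s`, so the
`⌊m^{9/10}⌋` form is equivalent to "for all `s` with `s^{10} ≤ m^9`").

Deliberately NOT here: Remark 1 (the doubling curve is not `(m−1, 2)`-elusive — an instance of the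
route's `LowMonomialCurvesSwallowed` / the tree's `not_elusive_candidate` pattern), Theorem 2
(expander exponent matrices ⇒ VP ≠ VNP; needs his Definitions 2 and 5), Theorem 4, Lemma 1.

## References

* A. K. Narayanan, *Arithmetic circuit lower bounds from sumset expansion*, arXiv:2607.15848v1
  (17 Jul 2026), Def. 1 and Thm. 1 (p. 2), remark p. 3 (READ). [Narayanan2026]
* R. Raz, *Elusive functions and lower bounds for arithmetic circuits*, Theory Comput. 6 (2010), Def. 1.1. [Raz2010]
-/

noncomputable section

namespace Literature.Computability.AlgebraicComplexity

/-- Narayanan's **doubling curve** `z ↦ (z, z², z⁴, …, z^{2^{m−1}})` as a monomial map on one variable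
(coordinate `i : Fin m` is `X₀^{2^i}`). [claim: Narayanan2026, status: under-review] -/
def doublingCurve (m : ℕ) : Fin m → MvPolynomial (Fin 1) ℂ :=
  fun i => (MvPolynomial.X 0 : MvPolynomial (Fin 1) ℂ) ^ (2 ^ (i : ℕ))

/-- NAMED FACT / CLAIM (**Narayanan 2026, Theorem 1**, arXiv:2607.15848 p. 2, unrefereed): "For large
enough `m`, `z ↦ (z, z², z⁴, …, z^{2^{m−1}})` is `(⌊m^{9/10}⌋, 2)`-elusive" (over `ℂ`, Def. 1 = Raz
Def. 1.1 = `IsElusive`). [claim: Narayanan2026, status: under-review] -/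
def Narayanan2026_thm1 : Prop :=
  ∃ m₀ : ℕ, ∀ m ≥ m₀, IsElusive (doublingCurve m) ⌊((m : ℝ) ^ ((9 : ℝ) / 10))⌋₊ 2

end Literature.Computability.AlgebraicComplexity
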